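import Literature.GroupTheory.CombinatorialGroupTheory.SchreierIndexFormula
import Literature.GroupTheory.CombinatorialGroupTheory.AbelianizationFinrank
import HarnessLib

/-!
# The Schreier index formula: rank forms

Topic `Literature/GroupTheory/CombinatorialGroupTheory`; theorems only.  Corollaries of
`SchreierIndexFormula.lean` (Lyndon–Schupp, *Combinatorial Group Theory*, Ch. I Prop. 3.9: a subgroup
of index `n` in a free group of rank `k` is free of rank `n (k - 1) + 1`) in the two forms consumers ask
for, both stated additively (no subtraction):

* `IsFreeGroup.card_generators_add_index` — with Mathlib's chosen bases `IsFreeGroup.Generators`: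
  `|Generators H| + [G : H] = [G : H] · |Generators G| + 1` (free bases of one group are equipotent,
  `Equiv.ofIsFreeGroupEquiv`);
* `IsFreeGroup.finrank_abelianization_add_index` — for the abelianisation as a `ℤ`-module
  (`AbelianizationFinrank.lean`): `rank_ℤ H^{ab} + [G : H] = [G : H] · |Generators G| + 1`.
-/

namespace Literature.GroupTheory.CombinatorialGroupTheory

universe u

/-- **Schreier's formula for the ranks of the chosen free bases**: for a subgroup `H` of finite index in
a free group `G` with finitely many free generators,
`|Generators H| + [G : H] = [G : H] · |Generators G| + 1`. [cite: LyndonSchupp2001, Ch. I Prop. 3.9] -/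
theorem IsFreeGroup.card_generators_add_index {G : Type u} [Group G] [IsFreeGroup G]
    [Finite (IsFreeGroup.Generators G)] (H : Subgroup G) [H.FiniteIndex] :
    Nat.card (IsFreeGroup.Generators H) + H.index = H.index * Nat.card (IsFreeGroup.Generators G) + 1 := by
  obtain ⟨ι, b, _, hcard⟩ := SchreierIndex.exists_freeGroupBasis_of_finiteIndex H
  -- the chosen basis of `H` is equipotent with `ι`
  have e : IsFreeGroup.Generators H ≃ ι :=
    Equiv.ofFreeGroupEquiv ((IsFreeGroup.toFreeGroup H).symm.trans b.repr)
  rw [Nat.card_congr e]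
  exact hcard

/-- **Schreier's formula for the rank of the abelianisation**: for `H` of finite index in a free group
`G` with finitely many free generators, `finrank ℤ (Additive (Abelianization H)) + [G : H] =
[G : H] · |Generators G| + 1`, and `Additive (Abelianization H)` is a finite `ℤ`-module.
[cite: LyndonSchupp2001, Ch. I Prop. 3.9] -/
theorem IsFreeGroup.finrank_abelianization_add_index {G : Type u} [Group G] [IsFreeGroup G]
    [Finite (IsFreeGroup.Generators G)] (H : Subgroup G) [H.FiniteIndex] :
    Module.finrank ℤ (Additive (Abelianization H)) + H.index =
        H.index * Nat.card (IsFreeGroup.Generators G) + 1 ∧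
      Module.Finite ℤ (Additive (Abelianization H)) := by
  obtain ⟨ι, b, hfin, hcard⟩ := SchreierIndex.exists_freeGroupBasis_of_finiteIndex H
  haveI := hfin
  obtain ⟨hrank, hfinite⟩ := finrank_additive_abelianization_eq_card b
  exact ⟨by rw [hrank]; exact hcard, hfinite⟩

/-- The `FreeGroup α` forms (`α` finite): `|Generators H| + [F : H] = [F : H] · |α| + 1` and
`finrank ℤ H^{ab} + [F : H] = [F : H] · |α| + 1`. [cite: LyndonSchupp2001, Ch. I Prop. 3.9] -/
theorem FreeGroup.card_generators_add_index {α : Type u} [Finite α] (H : Subgroup (FreeGroup α))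
    [H.FiniteIndex] :
    Nat.card (IsFreeGroup.Generators H) + H.index = H.index * Nat.card α + 1 ∧
      Module.finrank ℤ (Additive (Abelianization H)) + H.index = H.index * Nat.card α + 1 := by
  let e : α ≃ IsFreeGroup.Generators (FreeGroup α) :=
    Equiv.ofFreeGroupEquiv (IsFreeGroup.toFreeGroup (FreeGroup α))
  haveI : Finite (IsFreeGroup.Generators (FreeGroup α)) := Finite.of_equiv α e
  rw [Nat.card_congr e]
  exact ⟨IsFreeGroup.card_generators_add_index H, (IsFreeGroup.finrank_abelianization_add_index H).1⟩

end Literature.GroupTheory.CombinatorialGroupTheory
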